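import Literature.Algebra.Homology.DiscreteRepInvariantsQuotient
import Literature.Algebra.Homology.DiscreteRepExtInternalHom
import HarnessLib

/-!
# `Ext¹_{C_Γ}(Inf X, Y) = 0 ⟹ Ext¹_{C_{Γ/N}}(X, Y^N) = 0` for a CLOSED normal subgroup `N`:
# dimension shifting along the co-induced hull, and `(CoInd_Γ V)^N ≅ CoInd_{Γ/N} V`

Topic `Algebra/Homology`; namespace `Literature.Algebra.Homology.DiscreteRep`.  Sequel to -w7 g11's
`DiscreteRepInvariantsQuotient` (`invariantsQuotD k N : C_Γ ⥤ C_{Γ/N}`, the counit `invariantsInclQuot`) and door-c4's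
`DiscreteRepCoinduced` / `DiscreteRepExtInternalHom` (`coind k Γ V`, Frobenius reciprocity, `ext_eq_zero_of_iso_coind_of_projective`).
Plumbing definitions with bodies (`coindInvariantsIso`, the hull objects/maps, `adjInv`) and theorems; no named fact, no instance,
no `sorry`.

THE MATHEMATICS (the degree-one edge of the Hochschild–Serre spectral sequence `Ext^p_{Γ/N}(X, H^q(N, Y)) ⇒
Ext^{p+q}_Γ(Inf X, Y)`, proved by dimension shifting; Harari, *Galois Cohomology and CFT*, Remark 4.24 and §16.2;
Serre, *Cohomologie galoisienne* I §2.5–2.6).  Let `Γ` be a compact topological group, `N ≤ Γ` a normal subgroup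
(`Γ/N` with the quotient topology), `X ∈ C_{Γ/N}` with `X` PROJECTIVE as a `k`-module, `Y ∈ C_Γ`.
* §1 **`coindInvariantsIso : (CoInd_Γ V)^N ≅ CoInd_{Γ/N} V`** in `C_{Γ/N}`: an `N`-invariant locally constant
  `f : Γ → V` (`f(n⁻¹x) = f(x)`) is a locally constant function on `Γ/N` (the quotient map is open), and conversely.
  Hence `Ext^{q+1}_{C_{Γ/N}}(X, (CoInd_Γ V)^N) = 0` (`ext_invariantsQuotD_coind_eq_zero`, Shapiro + projectivity).
* §2 The co-induced hull `η : Y ↪ 𝕀 := CoInd_Γ(Y)` (`coindUnit`, `x ↦ (g ↦ ρ(g⁻¹) x)`, mono), `Q := coker η`, and in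
  `C_{Γ/N}` the sequence `0 → Y^N → 𝕀^N → Q' := coker(η^N) → 0` with the comparison `c : Q' → Q^N`, a MONOMORPHISM
  (an `N`-invariant element of `𝕀` dying in `Q` comes from `Y`, hence from `Y^N`).
* §3 **`ext_one_invariantsQuotD_eq_zero_of_infl`**: if `Ext¹_{C_Γ}(Inf X, Y) = 0` then `Ext¹_{C_{Γ/N}}(X, Y^N) = 0`.
  Proof: for `e ∈ Ext¹(X, Y^N)`, `e ≫ η^N ∈ Ext¹(X, 𝕀^N) = 0`, so `e = δ(φ)` with `φ : X → Q'`; the adjoint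
  `φ̃ : Inf X → Q` of `φ ≫ c` has `δ(φ̃) ∈ Ext¹_Γ(Inf X, Y) = 0`, so `φ̃ = ψ̃ ≫ p` with `ψ̃ : Inf X → 𝕀`, whose adjoint
  `ψ : X → 𝕀^N` satisfies `φ ≫ c = ψ ≫ η^N-quotient ≫ c`; `c` mono gives `φ = ψ ≫ (𝕀^N → Q')`, hence `δ(φ) = 0`.
  NO map `Ext¹_{Γ/N} → Ext¹_Γ` is constructed: only the vanishing is transported, which is what the lane needs
  (`Ext¹_{C_{G_S}}(P^S, J_{K_S}) = 0` from door-c4's `Ext¹_{C_{Γ_K}}(P, J̄) = 0`, sequel file).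

Cell bsd-eis, lane «PT-Ш-S-TC», brick D4b step F2f (seat bsd-line-x1-p1-w6 gen 11).  HONEST FRAMING: generic homological
algebra; nothing arithmetic is proved here.

## References
* D. Harari, *Galois Cohomology and Class Field Theory*, Universitext, Springer (2020), §4.3 Remark 4.24, §16.2
  Remark 16.13 and Proposition 16.16 (b). [Harari2020]
* J.-P. Serre, *Galois Cohomology*, Springer (1997), I §2.5 (induced modules), I §2.6 (b) (Hochschild–Serre). [SerreGaloisCohomology1997]
* C. A. Weibel, *An introduction to homological algebra* (1994), §6.8 (Hochschild–Serre), Lemma 6.3.2. [Weibel1994]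
-/

noncomputable section

universe u

namespace Literature.Algebra.Homology

namespace DiscreteRep

open CategoryTheory CategoryTheory.Limits CategoryTheory.Abelian

variable {k Γ : Type u} [CommRing k] [Group Γ] [TopologicalSpace Γ] [IsTopologicalGroup Γ] [CompactSpace Γ]
variable (N : Subgroup Γ) [N.Normal]

/-! ## §1. `(CoInd_Γ V)^N ≅ CoInd_{Γ/N} V` and the acyclicity of `(CoInd_Γ V)^N` -/

section CoindInvariants

variable (V : Type u)

omit [IsTopologicalGroup Γ] [CompactSpace Γ] in
/-- An `N`-invariant locally constant function on `Γ` (`f (n⁻¹ x) = f x`) as a locally constant function on `Γ/N`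
(the quotient map is open). [cite: SerreGaloisCohomology1997, I §2.5] -/
def descendLocallyConstant (f : LocallyConstant Γ V) (hf : ∀ n ∈ N, ∀ x : Γ, f (n⁻¹ * x) = f x) :
    LocallyConstant (Γ ⧸ N) V where
  toFun := Quotient.lift (s := QuotientGroup.leftRel N) f fun a b hab => by
    have hab' : a⁻¹ * b ∈ N := QuotientGroup.leftRel_apply.mp hab
    have hb : b = (a * (a⁻¹ * b) * a⁻¹)⁻¹⁻¹ * a := by group
    rw [hb]
    exact (hf _ (N.inv_mem (Subgroup.Normal.conj_mem inferInstance _ hab' a)) a).symm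
  isLocallyConstant := fun s => by
    rw [← (QuotientGroup.isQuotientMap_mk N).isOpen_preimage]
    exact f.isLocallyConstant s

omit [IsTopologicalGroup Γ] [CompactSpace Γ] in
/-- Formula: the descended function on a class is the value on a representative.
[cite: SerreGaloisCohomology1997, I §2.5] -/
@[simp]
theorem descendLocallyConstant_mk (f : LocallyConstant Γ V) (hf : ∀ n ∈ N, ∀ x : Γ, f (n⁻¹ * x) = f x) (x : Γ) :
    descendLocallyConstant N V f hf (QuotientGroup.mk x) = f x := rfl

omit [IsTopologicalGroup Γ] [CompactSpace Γ] in
/-- A locally constant function on `Γ/N` pulled back to `Γ` is `N`-invariant. [cite: SerreGaloisCohomology1997, I §2.5] -/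
theorem comap_mk_inv_mul (g : LocallyConstant (Γ ⧸ N) V) (n : Γ) (hn : n ∈ N) (x : Γ) :
    g.comap ⟨(QuotientGroup.mk : Γ → Γ ⧸ N), QuotientGroup.continuous_mk⟩ (n⁻¹ * x) =
      g.comap ⟨(QuotientGroup.mk : Γ → Γ ⧸ N), QuotientGroup.continuous_mk⟩ x := by
  rw [LocallyConstant.coe_comap_apply, LocallyConstant.coe_comap_apply]
  refine congrArg g ?_
  change (QuotientGroup.mk (n⁻¹ * x) : Γ ⧸ N) = QuotientGroup.mk x
  rw [QuotientGroup.eq, mul_inv_rev, inv_inv]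
  exact Subgroup.Normal.conj_mem' inferInstance n hn x

variable [AddCommGroup V] [Module k V]

/-- The underlying locally constant function `Γ → V` of a vector of `(CoInd_Γ V)^N`. [cite: SerreGaloisCohomology1997, I §2.5] -/
def coindInvariantsVal (w : ((invariantsQuotD k N).obj (coind k Γ V)).obj.V) : LocallyConstant Γ V := w.1

/-- Invariance of the underlying function: `f (n⁻¹ x) = f x`. [cite: SerreGaloisCohomology1997, I §2.5] -/
theorem coindInvariantsVal_inv_mul (w : ((invariantsQuotD k N).obj (coind k Γ V)).obj.V) (n : Γ) (hn : n ∈ N) (x : Γ) :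
    coindInvariantsVal N V w (n⁻¹ * x) = coindInvariantsVal N V w x := by
  have h : coindRepr k Γ V n (coindInvariantsVal N V w) = coindInvariantsVal N V w := w.2 ⟨n, hn⟩
  exact DFunLike.congr_fun h x

/-- The vectors of `(CoInd_Γ V)^N` → locally constant functions on `Γ/N`. [cite: SerreGaloisCohomology1997, I §2.5] -/
def coindInvariantsToFun (w : ((invariantsQuotD k N).obj (coind k Γ V)).obj.V) : LocallyConstant (Γ ⧸ N) V :=
  descendLocallyConstant N V (coindInvariantsVal N V w) (coindInvariantsVal_inv_mul N V w)

/-- Formula. [cite: SerreGaloisCohomology1997, I §2.5] -/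
@[simp]
theorem coindInvariantsToFun_mk (w : ((invariantsQuotD k N).obj (coind k Γ V)).obj.V) (x : Γ) :
    coindInvariantsToFun N V w (QuotientGroup.mk x) = coindInvariantsVal N V w x := rfl

/-- Locally constant functions on `Γ/N` → the vectors of `(CoInd_Γ V)^N`. [cite: SerreGaloisCohomology1997, I §2.5] -/
def coindInvariantsOfFun (g : LocallyConstant (Γ ⧸ N) V) : ((invariantsQuotD k N).obj (coind k Γ V)).obj.V :=
  ⟨g.comap ⟨(QuotientGroup.mk : Γ → Γ ⧸ N), QuotientGroup.continuous_mk⟩, fun n =>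
    LocallyConstant.ext fun x => by
      change (g.comap ⟨(QuotientGroup.mk : Γ → Γ ⧸ N), QuotientGroup.continuous_mk⟩) ((n : Γ)⁻¹ * x) = _
      exact comap_mk_inv_mul N V g n n.2 x⟩

/-- Formula. [cite: SerreGaloisCohomology1997, I §2.5] -/
@[simp]
theorem coindInvariantsVal_coindInvariantsOfFun_apply (g : LocallyConstant (Γ ⧸ N) V) (x : Γ) :
    coindInvariantsVal N V (coindInvariantsOfFun (k := k) N V g) x = g (QuotientGroup.mk x) := rfl

/-- **`(CoInd_Γ V)^N ≅ CoInd_{Γ/N} V` in `C_{Γ/N}`** (`N`-invariant locally constant functions on `Γ` are the locally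
constant functions on `Γ/N`; the actions `(γ • f)(x) = f(γ⁻¹x)` correspond). [cite: SerreGaloisCohomology1997, I §2.5]
[cite: Harari2020, §4.3 Remark 4.24] -/
def coindInvariantsIso : (invariantsQuotD k N).obj (coind k Γ V) ≅ coind k (Γ ⧸ N) V where
  hom := ObjectProperty.homMk (Rep.ofHom
    ⟨{ toFun := coindInvariantsToFun N V
       map_add' := fun w w' => LocallyConstant.ext fun q => QuotientGroup.induction_on q fun x => rfl
       map_smul' := fun c w => LocallyConstant.ext fun q => QuotientGroup.induction_on q fun x => rfl },
      fun γ => QuotientGroup.induction_on γ fun g => LinearMap.ext fun w =>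
        LocallyConstant.ext fun q => QuotientGroup.induction_on q fun x => by
          change coindInvariantsVal N V (((invariantsQuotD k N).obj (coind k Γ V)).obj.ρ (QuotientGroup.mk g) w) x =
            coindInvariantsVal N V w (g⁻¹ * x)
          rfl⟩)
  inv := ObjectProperty.homMk (Rep.ofHom
    ⟨{ toFun := coindInvariantsOfFun N V
       map_add' := fun g g' => Subtype.ext (LocallyConstant.ext fun x => rfl)
       map_smul' := fun c g => Subtype.ext (LocallyConstant.ext fun x => rfl) },
      fun γ => QuotientGroup.induction_on γ fun g => LinearMap.ext fun f => Subtype.ext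
        (LocallyConstant.ext fun x => by
          change f ((QuotientGroup.mk g : Γ ⧸ N)⁻¹ * QuotientGroup.mk x) = f (QuotientGroup.mk (g⁻¹ * x))
          rw [QuotientGroup.mk_mul, QuotientGroup.mk_inv])⟩)
  hom_inv_id := ObjectProperty.hom_ext _ (Rep.hom_ext (DFunLike.ext _ _ fun w => Subtype.ext
    (LocallyConstant.ext fun x => rfl)))
  inv_hom_id := ObjectProperty.hom_ext _ (Rep.hom_ext (DFunLike.ext _ _ fun g =>
    LocallyConstant.ext fun q => QuotientGroup.induction_on q fun x => rfl))

/-- **`Ext^{q+1}_{C_{Γ/N}}(X, (CoInd_Γ V)^N) = 0` for `X` projective over `k`** (Shapiro at `Γ/N` and projectivity, via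
`coindInvariantsIso`). [cite: Harari2020, §16.2 Remark 16.13, Proposition 16.16 (b)] [cite: SerreGaloisCohomology1997, I §2.5] -/
theorem ext_invariantsQuotD_coind_eq_zero (X : DiscreteRepCat k (Γ ⧸ N)) [Module.Projective k X.obj.V] (q : ℕ)
    (e : Ext X ((invariantsQuotD k N).obj (coind k Γ V)) (q + 1)) : e = 0 :=
  ext_eq_zero_of_iso_coind_of_projective X (coindInvariantsIso N V) q e

end CoindInvariants

/-! ## §2. The co-induced hull `Y ↪ 𝕀 ↠ Q` and its `N`-invariants `Y^N ↪ 𝕀^N ↠ Q' ↪ Q^N` -/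

section Hull

variable (Y : DiscreteRepCat k Γ)

/-- **The co-induced hull `η : Y ⟶ CoInd_Γ(Y)`**, `y ↦ (g ↦ ρ(g⁻¹) y)` (unit of `forget ⊣ CoInd`).
[cite: SerreGaloisCohomology1997, I §2.5] -/
def coindUnit : Y ⟶ coind k Γ Y.obj.V :=
  letI : Module k Y.obj.V := Y.obj.hV2
  coindLift Y LinearMap.id

/-- Formula: `(η y) g = ρ(g⁻¹) y`. [cite: SerreGaloisCohomology1997, I §2.5] -/
@[simp]
theorem coindUnit_apply_apply (y : Y.obj.V) (g : Γ) : (coindUnit Y).hom.hom y g = Y.obj.ρ g⁻¹ y :=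
  coindLift_apply_apply Y _ y g

/-- `η` is injective (evaluate at `1`). [cite: SerreGaloisCohomology1997, I §2.5] -/
theorem coindUnit_injective : Function.Injective (coindUnit Y).hom.hom := fun y y' h => by
  have h1 := DFunLike.congr_fun h 1
  rw [coindUnit_apply_apply, coindUnit_apply_apply, inv_one, map_one] at h1
  exact h1

/-- `η` is a monomorphism. [cite: SerreGaloisCohomology1997, I §2.5] -/
theorem mono_coindUnit : Mono (coindUnit Y) :=
  (ι k Γ).mono_of_mono_map ((Rep.mono_iff_injective _).2 (coindUnit_injective Y))

/-- **The hull sequence `0 → Y → CoInd_Γ(Y) → Q → 0`** (`Q := coker η`). [cite: SerreGaloisCohomology1997, I §2.5] -/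
abbrev hullSC : ShortComplex (DiscreteRepCat k Γ) :=
  ShortComplex.mk (coindUnit Y) (cokernel.π (coindUnit Y)) (by simp)

/-- The hull sequence is short exact. [cite: SerreGaloisCohomology1997, I §2.5] -/
theorem hullSC_shortExact : (hullSC Y).ShortExact :=
  ShortComplex.ShortExact.mk' (ShortComplex.exact_cokernel (coindUnit Y))
    (by dsimp only [hullSC]; exact mono_coindUnit Y) (by dsimp only [hullSC]; infer_instance)

/-- `η^N : Y^N ⟶ 𝕀^N` is a monomorphism. [cite: Harari2020, §4.3 Remark 4.24] -/
theorem mono_invariantsQuotD_map_coindUnit : Mono ((invariantsQuotD k N).map (coindUnit Y)) :=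
  (ι k (Γ ⧸ N)).mono_of_mono_map ((Rep.mono_iff_injective _).2 fun _ _ h =>
    Subtype.ext (coindUnit_injective Y (congrArg Subtype.val h)))

/-- **The `N`-invariant hull sequence `0 → Y^N → 𝕀^N → Q' → 0`** in `C_{Γ/N}` (`Q' := coker (η^N)`).
[cite: Harari2020, §4.3 Remark 4.24] -/
abbrev hullInvSC : ShortComplex (DiscreteRepCat k (Γ ⧸ N)) :=
  ShortComplex.mk ((invariantsQuotD k N).map (coindUnit Y)) (cokernel.π ((invariantsQuotD k N).map (coindUnit Y)))
    (by simp)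

/-- The `N`-invariant hull sequence is short exact. [cite: Harari2020, §4.3 Remark 4.24] -/
theorem hullInvSC_shortExact : (hullInvSC N Y).ShortExact :=
  ShortComplex.ShortExact.mk' (ShortComplex.exact_cokernel ((invariantsQuotD k N).map (coindUnit Y)))
    (by dsimp only [hullInvSC]; exact mono_invariantsQuotD_map_coindUnit N Y) (by dsimp only [hullInvSC]; infer_instance)

/-- **The comparison `c : Q' ⟶ Q^N`** (`η^N ≫ p^N = 0`). [cite: Harari2020, §4.3 Remark 4.24] -/
def hullCompare : (hullInvSC N Y).X₃ ⟶ (invariantsQuotD k N).obj (hullSC Y).X₃ :=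
  cokernel.desc _ ((invariantsQuotD k N).map (hullSC Y).g) (by
    rw [← Functor.map_comp]
    change (invariantsQuotD k N).map ((hullSC Y).f ≫ (hullSC Y).g) = 0
    rw [(hullSC Y).zero, Functor.map_zero])

/-- `(𝕀^N ↠ Q') ≫ c = p^N`. [cite: Harari2020, §4.3 Remark 4.24] -/
@[simp]
theorem hullInvSC_g_comp_hullCompare : (hullInvSC N Y).g ≫ hullCompare N Y = (invariantsQuotD k N).map (hullSC Y).g :=
  cokernel.π_desc _ _ _

/-- On vectors `c (π i) = p^N i`. [cite: Harari2020, §4.3 Remark 4.24] -/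
theorem hullCompare_g_apply (i : (hullInvSC N Y).X₂.obj.V) :
    (hullCompare N Y).hom.hom ((hullInvSC N Y).g.hom.hom i) = ((invariantsQuotD k N).map (hullSC Y).g).hom.hom i :=
  congrArg (fun φ => φ.hom.hom i) (hullInvSC_g_comp_hullCompare N Y)

/-- **`c : Q' ⟶ Q^N` is a monomorphism**: an `N`-invariant vector of `𝕀` dying in `Q` comes from `Y` (exactness of the
hull), hence from `Y^N` (`η` is injective and equivariant), so its class in `Q'` vanishes. [cite: Harari2020, §4.3 Remark 4.24] -/
theorem mono_hullCompare : Mono (hullCompare N Y) := by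
  apply (ι k (Γ ⧸ N)).mono_of_mono_map
  rw [Rep.mono_iff_injective]
  intro z₁ z₂ hz
  change (hullCompare N Y).hom.hom z₁ = (hullCompare N Y).hom.hom z₂ at hz
  obtain ⟨i₁, rfl⟩ := shortExact_g_surjective (hullInvSC_shortExact N Y) z₁
  obtain ⟨i₂, rfl⟩ := shortExact_g_surjective (hullInvSC_shortExact N Y) z₂
  rw [hullCompare_g_apply, hullCompare_g_apply] at hz
  -- the difference `d := i₁ - i₂`, an `N`-invariant vector of `𝕀` dying in `Q`
  have hz' : (hullSC Y).g.hom.hom (i₁ - i₂).1 = 0 := by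
    have h0 : ((invariantsQuotD k N).map (hullSC Y).g).hom.hom (i₁ - i₂) = 0 := by
      rw [map_sub]
      exact sub_eq_zero.2 hz
    exact congrArg Subtype.val h0
  obtain ⟨y, hy⟩ := exact_apply (hullSC_shortExact Y).exact _ hz'
  -- `y` is `N`-invariant
  have hyN : ∀ n : N, (Y.obj.ρ.comp N.subtype) n y = y := fun n => coindUnit_injective Y (by
    change (hullSC Y).f.hom.hom (Y.obj.ρ n y) = (hullSC Y).f.hom.hom y
    rw [Rep.hom_comm_apply, hy]
    exact (i₁ - i₂).2 n)
  have hw : (hullInvSC N Y).f.hom.hom ⟨y, hyN⟩ = i₁ - i₂ := Subtype.ext hy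
  have h1 : (hullInvSC N Y).g.hom.hom (i₁ - i₂) = 0 := by
    rw [← hw]
    exact shortComplex_g_f_apply (hullInvSC N Y) _
  rwa [map_sub, sub_eq_zero] at h1

end Hull

/-! ## §3. `Ext¹_{C_Γ}(Inf X, Y) = 0 ⟹ Ext¹_{C_{Γ/N}}(X, Y^N) = 0` -/

section Main

variable (X : DiscreteRepCat k (Γ ⧸ N))

omit [CompactSpace Γ] in
/-- The adjoint `X ⟶ Z^N` of a `Γ`-morphism `Inf X ⟶ Z` (door-c4's `homInfToInvariants` in `C_Γ`-currency).
[cite: Harari2020, §4.3 Remark 4.24] -/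
def adjInv {Z : DiscreteRepCat k Γ} (g : (inflQuotFunctor k N).obj X ⟶ Z) : X ⟶ (invariantsQuotD k N).obj Z :=
  ObjectProperty.homMk (homInfToInvariants N X.obj Z.obj g.hom)

omit [CompactSpace Γ] in
/-- Formula: `(adjInv g x).1 = g x`. [cite: Harari2020, §4.3 Remark 4.24] -/
@[simp]
theorem coe_adjInv_apply {Z : DiscreteRepCat k Γ} (g : (inflQuotFunctor k N).obj X ⟶ Z) (x : X.obj.V) :
    ((adjInv N X g).hom.hom x).1 = g.hom.hom x := rfl

omit [CompactSpace Γ] in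
/-- Naturality of the adjoint in the target. [cite: Harari2020, §4.3 Remark 4.24] -/
theorem adjInv_comp_map {Z Z' : DiscreteRepCat k Γ} (g : (inflQuotFunctor k N).obj X ⟶ Z) (f : Z ⟶ Z') :
    adjInv N X (g ≫ f) = adjInv N X g ≫ (invariantsQuotD k N).map f :=
  ObjectProperty.hom_ext _ (Rep.hom_ext (DFunLike.ext _ _ fun _ => Subtype.ext rfl))

omit [CompactSpace Γ] in
/-- The adjoint of `Inf h ≫ (Z^N ↪ Z)` is `h`. [cite: Harari2020, §4.3 Remark 4.24] -/
theorem adjInv_map_comp_invariantsInclQuot {Z : DiscreteRepCat k Γ} (h : X ⟶ (invariantsQuotD k N).obj Z) :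
    adjInv N X ((inflQuotFunctor k N).map h ≫ invariantsInclQuot N Z) = h :=
  ObjectProperty.hom_ext _ (Rep.hom_ext (DFunLike.ext _ _ fun _ => Subtype.ext rfl))

variable [Module.Projective k X.obj.V] (Y : DiscreteRepCat k Γ)

/-- **`Ext¹_{C_Γ}(Inf X, Y) = 0 ⟹ Ext¹_{C_{Γ/N}}(X, Y^N) = 0`** for `X` projective over `k` (the degree-one edge of
Hochschild–Serre, by dimension shifting along the co-induced hull; see the module docstring).
[cite: Harari2020, §4.3 Remark 4.24, §16.2 Proposition 16.16 (b)] [cite: SerreGaloisCohomology1997, I §2.6 (b)] -/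
theorem ext_one_invariantsQuotD_eq_zero_of_infl
    (h : ∀ e : Ext ((inflQuotFunctor k N).obj X) Y 1, e = 0)
    (e : Ext X ((invariantsQuotD k N).obj Y) 1) : e = 0 := by
  -- Step A: `e ≫ η^N = 0` in `Ext¹(X, 𝕀^N)`, so `e = δ(φ₀)` for some `φ₀ : X ⟶ Q'`
  have hA : e.comp (Ext.mk₀ (hullInvSC N Y).f) (add_zero 1) = 0 :=
    ext_invariantsQuotD_coind_eq_zero N Y.obj.V X 0 _
  obtain ⟨φ, hφ⟩ := Ext.covariant_sequence_exact₁ (hS := hullInvSC_shortExact N Y) _ e hA (zero_add 1)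
  obtain ⟨φ₀, rfl⟩ := (Ext.mk₀_bijective _ _).2 φ
  -- Step B: the adjoint `Γ`-map `φ̃ : Inf X ⟶ Q` of `φ₀ ≫ c` lifts through `p : 𝕀 ⟶ Q`
  let φt : (inflQuotFunctor k N).obj X ⟶ (hullSC Y).X₃ :=
    (inflQuotFunctor k N).map (φ₀ ≫ hullCompare N Y) ≫ invariantsInclQuot N (hullSC Y).X₃
  have hB : (Ext.mk₀ φt).comp (hullSC_shortExact Y).extClass (zero_add 1) = 0 := h _
  obtain ⟨ψ, hψ⟩ := Ext.covariant_sequence_exact₃ (hS := hullSC_shortExact Y) _ (Ext.mk₀ φt) (zero_add 1) hB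
  obtain ⟨ψ₀, rfl⟩ := (Ext.mk₀_bijective _ _).2 ψ
  rw [Ext.mk₀_comp_mk₀] at hψ
  have hψt : ψ₀ ≫ (hullSC Y).g = φt := (Ext.mk₀_bijective _ _).1 hψ
  have hC : adjInv N X ψ₀ ≫ (invariantsQuotD k N).map (hullSC Y).g = φ₀ ≫ hullCompare N Y := by
    rw [← adjInv_comp_map, hψt]
    exact adjInv_map_comp_invariantsInclQuot N X _
  -- Step C: `c` mono ⟹ `φ₀ = ψ ≫ (𝕀^N ↠ Q')`, so `δ(φ₀) = 0`
  have hD : φ₀ = adjInv N X ψ₀ ≫ (hullInvSC N Y).g := by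
    haveI := mono_hullCompare N Y
    rw [← cancel_mono (hullCompare N Y), Category.assoc, hullInvSC_g_comp_hullCompare, hC]
  rw [← hφ, hD, ← Ext.mk₀_comp_mk₀, Ext.comp_assoc_of_second_deg_zero, (hullInvSC_shortExact N Y).comp_extClass,
    Ext.comp_zero]

end Main


end DiscreteRep

end Literature.Algebra.Homology

end
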